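import Mathlib.Analysis.InnerProductSpace.Harmonic.Basic
import Mathlib.Analysis.Calculus.FDeriv.Analytic
import Mathlib.Analysis.Analytic.Uniqueness
import HarnessLib

/-!
# Harmonicity propagates along real-analytic continuation

Analysis support file (everything proved; no definitions, no named facts).

If `f` is real-analytic on an open preconnected set `U` of a finite-dimensional real inner
product space and harmonic at ONE point of `U`, then `f` is harmonic on all of `U`: the Laplacian
`Δ f = ∑ᵢ D²f(x)[eᵢ, eᵢ]` of a real-analytic function is real-analytic
(`analyticOnNhd_laplacian`), it vanishes near the given point, so it vanishes on `U` by the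
identity theorem (`AnalyticOnNhd.eqOn_zero_of_preconnected_of_eventuallyEq_zero`). [folklore]

Mathlib search: `InnerProductSpace.HarmonicAt`, `laplacian_eq_iteratedFDeriv_orthonormalBasis`,
`AnalyticOnNhd.iteratedFDeriv`, `ContinuousLinearMap.comp_analyticOnNhd`,
`Finset.analyticOnNhd_sum`; no ready-made statement
(`lean search 'AnalyticOnNhd.*laplacian|laplacian.*AnalyticOn|harmonicOnNhd_of_analytic'`:
nothing; Mathlib has the converse, harmonic ⇒ analytic, in the plane only,
`Mathlib.Analysis.Complex.Harmonic.Analytic`).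

## References

* S. Axler, P. Bourdon, W. Ramey, *Harmonic Function Theory* (2001), Thm. 1.27 and §1
  (real-analyticity and unique continuation of harmonic functions).
-/

noncomputable section

open Set Filter InnerProductSpace
open _root_.Topology
open scoped Laplacian

namespace Literature.Analysis.FluidPDE

variable {E : Type*} [NormedAddCommGroup E] [InnerProductSpace ℝ E] [FiniteDimensional ℝ E]
  {F : Type*} [NormedAddCommGroup F] [NormedSpace ℝ F] [CompleteSpace F]

/-- **The Laplacian of a real-analytic function is real-analytic** (it is a finite sum of
evaluations of the second derivative, which is analytic). [folklore] -/
theorem analyticOnNhd_laplacian {f : E → F} {s : Set E} (hf : AnalyticOnNhd ℝ f s) :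
    AnalyticOnNhd ℝ (Δ f) s := by
  set b := stdOrthonormalBasis ℝ E
  rw [laplacian_eq_iteratedFDeriv_orthonormalBasis f b]
  have h2 := hf.iteratedFDeriv 2
  have hi : ∀ i, AnalyticOnNhd ℝ (fun x => iteratedFDeriv ℝ 2 f x ![b i, b i]) s := fun i =>
    (ContinuousMultilinearMap.apply ℝ (fun _ : Fin 2 => E) F ![b i, b i]).comp_analyticOnNhd h2
  have hsum := Finset.analyticOnNhd_sum (Finset.univ : Finset (Fin (Module.finrank ℝ E)))
    (fun i _ => hi i)
  have e : (∑ i ∈ (Finset.univ : Finset (Fin (Module.finrank ℝ E))),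
      fun x => iteratedFDeriv ℝ 2 f x ![b i, b i]) =
      fun x => ∑ i, iteratedFDeriv ℝ 2 f x ![b i, b i] := by
    funext x
    exact Finset.sum_apply x _ _
  rwa [e] at hsum

/-- **Harmonicity propagates along real-analytic continuation.** If `f` is real-analytic on an
open preconnected set `U` and harmonic at one point `x₀ ∈ U`, then `f` is harmonic on `U`
(identity theorem for the real-analytic function `Δ f`). [folklore] -/
theorem harmonicOnNhd_of_analyticOnNhd_of_harmonicAt {f : E → F} {U : Set E} (hU : IsOpen U)
    (hUc : IsPreconnected U) (hf : AnalyticOnNhd ℝ f U) {x₀ : E} (hx₀ : x₀ ∈ U)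
    (h₀ : HarmonicAt f x₀) : HarmonicOnNhd f U := by
  intro x hx
  have hΔ : EqOn (Δ f) 0 U :=
    (analyticOnNhd_laplacian hf).eqOn_zero_of_preconnected_of_eventuallyEq_zero hUc hx₀ h₀.2
  exact ⟨(hf x hx).contDiffAt, Filter.eventually_of_mem (hU.mem_nhds hx) fun y hy => hΔ hy⟩

end Literature.Analysis.FluidPDE
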